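import Literature.Geometry.GaugeTheory.SeibergWittenAPrioriBoundPerturbed
import Literature.Geometry.GaugeTheory.SeibergWittenChartIndependence
import Literature.Geometry.GaugeTheory.SeibergWittenPerturbationSpace
import Literature.Geometry.Kaehler.ManifoldFormsEval
import HarnessLib

/-!
# The pointwise norm `|η⁺(x)|` of a perturbation: frame independence, continuity, boundedness

Topic `Literature/Geometry/GaugeTheory`; continues `SeibergWittenAPrioriBoundPerturbed`
(`perturbationNorm η i x = √(Σ_k sdCoeff_k²)`, the size of the self-dual 2-form `η` at `x` read in
the frame of the chart `i`, entering Morgan's a priori bound `|ψ|² ≤ max(2|η⁺| - κ, 0)`,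
Prop. 6.4.1), `SeibergWittenChartIndependence` (`ρ⁺(η)` transforms by unitary conjugation under a
change of chart) and `SeibergWittenPerturbationSpace` (the vector space of perturbations).

* `sum_sdCoeff_sq_chart_eq`, `perturbationNorm_chart_eq`: **`|η⁺(x)|` does not depend on the chart**
  (`ρ⁺(η)² = -|η⁺|²·1`, Morgan Lemma 2.3.4, and `ρ⁺` changes by unitary conjugation);
* `continuousAt_perturbationNorm`, `continuous_perturbationNorm_indexAt`: it is a continuous
  function on `X` (a smooth form evaluated on the smooth frames);
* `bddAbove_range_perturbationNorm`: hence **bounded on a compact `X`** — the `max_{y∈X} |h(y)|` of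
  Morgan's bound "`|ψ(x)|² ≤ max(max_{y∈X}(4|h(y)| - κ(y)), 0)`" (Prop. 6.4.1) is finite;
* `perturbationNorm_sub_le`, `perturbationNorm_smul`: it is a seminorm in `η`
  (`|(η₁ - η₂)⁺| ≤ |η₁⁺| + |η₂⁺|`, `|(cη)⁺| = |c||η⁺|`);
* `hermNormSq_le_ciSup_perturbed`: the a priori bound with an `x₀`-free right-hand side,
  `|ψ(x)|² ≤ sup_y 2|η⁺(y)| + sup_y max(-κ(y), 0)`.

PROVED, 0 named facts.

## References

* J. W. Morgan, *The Seiberg–Witten Equations and Applications to the Topology of Smooth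
  Four-Manifolds*, Princeton Math. Notes 44 (1996), Lemma 2.3.4, §6.1, Prop. 6.4.1. [MorganSWBook1996]
-/

noncomputable section

open scoped Manifold ContDiff Topology Matrix
open Set Function Filter Complex Bundle
open Literature.Geometry.Lorentzian (PseudoRiemannianMetric)
open Literature.Topology.FourManifolds (SmoothOrientation)
open Literature.Geometry.Kaehler (MForm IsSmoothForm)

namespace Literature.Geometry.GaugeTheory

/-- `sdCoeff` is additive. [folklore] -/
theorem sdCoeff_sub' (A B : Matrix (Fin 4) (Fin 4) ℝ) : sdCoeff (A - B) = sdCoeff A - sdCoeff B := by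
  funext k
  fin_cases k <;> simp [sdCoeff] <;> ring

/-- `sdCoeff` is homogeneous. [folklore] -/
theorem sdCoeff_smul' (c : ℝ) (A : Matrix (Fin 4) (Fin 4) ℝ) : sdCoeff (c • A) = c • sdCoeff A := by
  funext k
  fin_cases k <;> simp [sdCoeff] <;> ring

variable {X : Type*} [TopologicalSpace X] [ChartedSpace (EuclideanSpace ℝ (Fin 4)) X] [IsManifold (𝓡 4) ∞ X]
  {g : PseudoRiemannianMetric (𝓡 4) ∞ (EuclideanSpace ℝ (Fin 4)) (TangentSpace (𝓡 4) : X → Type _)}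
  {o : SmoothOrientation (𝓡 4) X} {ι : Type*}

namespace SpincStructure

variable (𝔰 : SpincStructure g o ι)

/-! ### Frame independence -/

/-- **`|η⁺(x)|² = Σ_k sdCoeff_k²` is the same in the frames of any two charts at `x`**: `ρ⁺(η)_i` and
`ρ⁺(η)_j` are unitarily conjugate (`plusAction_twoFormMatrix_eq`) and `ρ⁺(θ)² = -|θ⁺|²·1`.
[cite: MorganSWBook1996, Lemma 2.3.4] -/
theorem sum_sdCoeff_sq_chart_eq (η : 𝔰.Perturbation) (i j : ι) {x : X} (hx : x ∈ 𝔰.baseSet i ∩ 𝔰.baseSet j) :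
    ∑ k : Fin 3, sdCoeff (twoFormMatrix η.form x fun l ↦ 𝔰.frame i l x) k ^ 2 =
      ∑ k : Fin 3, sdCoeff (twoFormMatrix η.form x fun l ↦ 𝔰.frame j l x) k ^ 2 := by
  set P := plusAction (twoFormMatrix η.form x fun l ↦ 𝔰.frame i l x) with hP
  set Q := plusAction (twoFormMatrix η.form x fun l ↦ 𝔰.frame j l x) with hQ
  set U := (𝔰.transition i j x).toBlocks₁₁ with hU
  have hPQ : P = U * Q * Uᴴ := 𝔰.plusAction_twoFormMatrix_eq η i j hx
  have hUU : Uᴴ * U = 1 := 𝔰.toBlocks₁₁_conjTranspose_mul_self i j hx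
  have hUU' : U * Uᴴ = 1 := 𝔰.toBlocks₁₁_mul_conjTranspose_self i j hx
  have hP2 : P * P = U * (Q * Q) * Uᴴ := by
    rw [hPQ]
    calc U * Q * Uᴴ * (U * Q * Uᴴ) = U * (Q * (Uᴴ * U) * Q) * Uᴴ := by simp only [Matrix.mul_assoc]
      _ = U * (Q * Q) * Uᴴ := by rw [hUU, Matrix.mul_one]
  rw [hP, hQ, plusAction_mul_self, plusAction_mul_self] at hP2
  simp only [Matrix.mul_neg, Matrix.neg_mul, neg_inj, Matrix.mul_smul, Matrix.smul_mul, Matrix.mul_one,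
    hUU'] at hP2
  have h00 := congr_fun (congr_fun hP2 0) 0
  simp only [Matrix.smul_apply, Matrix.one_apply_eq, smul_eq_mul, mul_one] at h00
  exact_mod_cast h00

/-- **`|η⁺(x)|` does not depend on the chart.** [cite: MorganSWBook1996, Lemma 2.3.4] -/
theorem perturbationNorm_chart_eq (η : 𝔰.Perturbation) (i j : ι) {x : X} (hx : x ∈ 𝔰.baseSet i ∩ 𝔰.baseSet j) :
    𝔰.perturbationNorm η i x = 𝔰.perturbationNorm η j x := by
  unfold perturbationNorm
  rw [𝔰.sum_sdCoeff_sq_chart_eq η i j hx]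

/-! ### Continuity and boundedness -/

/-- The entries `η(e_a, e_b)(y)` of the coefficient matrix are continuous (indeed smooth) on `U_i`.
[folklore] -/
theorem continuousAt_twoFormMatrix_apply (η : 𝔰.Perturbation) (i : ι) {x : X} (hx : x ∈ 𝔰.baseSet i) (a b : Fin 4) :
    ContinuousAt (fun y ↦ twoFormMatrix η.form y (fun l ↦ 𝔰.frame i l y) a b) x := by
  have h := IsSmoothForm.contMDiffAt_apply_sections η.isSmoothForm (V := ![𝔰.frame i a, 𝔰.frame i b]) (x₀ := x)
    (fun k ↦ by fin_cases k <;> exact 𝔰.contMDiffAt_frame i _ hx)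
  refine (h.continuousAt).congr (Eventually.of_forall fun y ↦ ?_)
  simp only [twoFormMatrix_apply]
  congr 1
  funext k
  fin_cases k <;> rfl

/-- `y ↦ |η⁺(y)|` (read in the fixed chart `i`) is continuous on `U_i`. [folklore] -/
theorem continuousAt_perturbationNorm (η : 𝔰.Perturbation) (i : ι) {x : X} (hx : x ∈ 𝔰.baseSet i) :
    ContinuousAt (fun y ↦ 𝔰.perturbationNorm η i y) x := by
  unfold perturbationNorm
  have hsd : ∀ k : Fin 3, ContinuousAt (fun y ↦ sdCoeff (twoFormMatrix η.form y fun l ↦ 𝔰.frame i l y) k) x := by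
    intro k
    fin_cases k <;>
      simp only [sdCoeff, Fin.zero_eta, Fin.isValue, Matrix.cons_val_zero, Fin.mk_one, Matrix.cons_val_one,
        Matrix.cons_val, Fin.reduceFinMk] <;>
      exact (𝔰.continuousAt_twoFormMatrix_apply η i hx _ _).add (𝔰.continuousAt_twoFormMatrix_apply η i hx _ _)
  exact (tendsto_finsetSum _ fun k _ ↦ (hsd k).pow 2).sqrt

/-- **`y ↦ |η⁺(y)|` (read at each point in the chart `indexAt y`) is continuous on `X`** (near `y₀` it
is the continuous `|η⁺|` of the chart `indexAt y₀`, by frame independence). [cite: MorganSWBook1996, Prop. 6.4.1] -/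
theorem continuous_perturbationNorm_indexAt (η : 𝔰.Perturbation) :
    Continuous fun y ↦ 𝔰.perturbationNorm η (𝔰.indexAt y) y := by
  refine continuous_iff_continuousAt.2 fun y₀ ↦ ?_
  have hev : (fun y ↦ 𝔰.perturbationNorm η (𝔰.indexAt y) y) =ᶠ[𝓝 y₀] fun y ↦ 𝔰.perturbationNorm η (𝔰.indexAt y₀) y := by
    filter_upwards [(𝔰.isOpen_baseSet _).mem_nhds (𝔰.mem_baseSet_indexAt y₀)] with y hy
    exact 𝔰.perturbationNorm_chart_eq η _ _ ⟨𝔰.mem_baseSet_indexAt y, hy⟩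
  exact (continuousAt_congr hev).2 (𝔰.continuousAt_perturbationNorm η _ (𝔰.mem_baseSet_indexAt y₀))

/-- **On a compact `X`, `|η⁺|` is bounded** (`max_{y∈X}|h(y)| < ∞` in Prop. 6.4.1). [cite: MorganSWBook1996, Prop. 6.4.1] -/
theorem bddAbove_range_perturbationNorm [CompactSpace X] (η : 𝔰.Perturbation) :
    BddAbove (range fun y ↦ 𝔰.perturbationNorm η (𝔰.indexAt y) y) :=
  (isCompact_range (𝔰.continuous_perturbationNorm_indexAt η)).bddAbove

/-- `|η⁺(x)| ≥ 0`. [folklore] -/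
theorem perturbationNorm_nonneg (η : 𝔰.Perturbation) (i : ι) (x : X) : 0 ≤ 𝔰.perturbationNorm η i x :=
  Real.sqrt_nonneg _

/-! ### A seminorm in `η` -/

/-- `|η⁺(x)|` is the Euclidean norm of the vector of self-dual coefficients. [folklore] -/
theorem perturbationNorm_eq_norm (η : 𝔰.Perturbation) (i : ι) (x : X) :
    𝔰.perturbationNorm η i x = ‖WithLp.toLp 2 (sdCoeff (twoFormMatrix η.form x fun l ↦ 𝔰.frame i l x))‖ := by
  rw [perturbationNorm, EuclideanSpace.norm_eq]
  simp only [Real.norm_eq_abs, sq_abs]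

/-- **Triangle inequality** `|(η₁ - η₂)⁺(x)| ≤ |η₁⁺(x)| + |η₂⁺(x)|`. [folklore] -/
theorem perturbationNorm_sub_le (η₁ η₂ : 𝔰.Perturbation) (i : ι) (x : X) :
    𝔰.perturbationNorm (η₁ - η₂) i x ≤ 𝔰.perturbationNorm η₁ i x + 𝔰.perturbationNorm η₂ i x := by
  simp only [perturbationNorm_eq_norm, Perturbation.twoFormMatrix_sub, sdCoeff_sub', WithLp.toLp_sub]
  exact norm_sub_le _ _

/-- **Homogeneity** `|(cη)⁺(x)| = |c|·|η⁺(x)|`. [folklore] -/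
theorem perturbationNorm_smul (c : ℝ) (η : 𝔰.Perturbation) (i : ι) (x : X) :
    𝔰.perturbationNorm (c • η) i x = |c| * 𝔰.perturbationNorm η i x := by
  rw [perturbationNorm_eq_norm, perturbationNorm_eq_norm, Perturbation.twoFormMatrix_smul, sdCoeff_smul', WithLp.toLp_smul,
    norm_smul, Real.norm_eq_abs]

/-! ### The a priori bound with a point-free right-hand side -/

/-- **Prop. 6.4.1 with the suprema**: on a compact `X`, every (smooth) solution `(A, ψ)` of `(SW_η)`
satisfies `|ψ(x)|² ≤ sup_y 2|η⁺(y)| + sup_y max(-κ(y), 0)` for all `x` — Morgan's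
"`|ψ(x)|² ≤ max(max_{y∈X}(4|h(y)| - κ(y)), 0)`" (with `max(a - κ) ≤ max a + max κ⁻`).
[cite: MorganSWBook1996, Prop. 6.4.1] -/
theorem hermNormSq_le_ciSup_perturbed [g.HasLeviCivita] [CompactSpace X] {η : 𝔰.Perturbation} {c : 𝔰.Configuration}
    (hsol : IsSolution η c) (x : X) :
    c.spinor.hermNormSq x ≤ (⨆ y, 2 * 𝔰.perturbationNorm η (𝔰.indexAt y) y) + ⨆ y, max (-g.scalarCurvature y) 0 := by
  obtain ⟨x₀, h1, h2⟩ := 𝔰.exists_forall_hermNormSq_le_perturbed hsol x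
  have hb1 : BddAbove (range fun y ↦ 2 * 𝔰.perturbationNorm η (𝔰.indexAt y) y) := by
    obtain ⟨M, hM⟩ := 𝔰.bddAbove_range_perturbationNorm η
    refine ⟨2 * M, ?_⟩
    rintro _ ⟨y, rfl⟩
    have := hM ⟨y, rfl⟩
    dsimp only
    linarith
  have hle1 : 2 * 𝔰.perturbationNorm η (𝔰.indexAt x₀) x₀ ≤ ⨆ y, 2 * 𝔰.perturbationNorm η (𝔰.indexAt y) y :=
    le_ciSup hb1 x₀
  have hle2 : max (-g.scalarCurvature x₀) 0 ≤ ⨆ y, max (-g.scalarCurvature y) 0 :=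
    le_ciSup (bddAbove_range_scalarCurvatureNeg g) x₀
  have h0 : 0 ≤ 2 * 𝔰.perturbationNorm η (𝔰.indexAt x₀) x₀ := by
    have := 𝔰.perturbationNorm_nonneg η (𝔰.indexAt x₀) x₀
    linarith
  refine h1.trans (h2.trans (max_le ?_ ?_))
  · linarith [le_max_left (-g.scalarCurvature x₀) 0]
  · linarith [le_max_right (-g.scalarCurvature x₀) 0]

end SpincStructure

end Literature.Geometry.GaugeTheory

end
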